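import Summits.QuantumFields.YangMills.Theorems.PoincareLipschitzSphereMapSmallEnergyMollified
import Summits.QuantumFields.YangMills.Theorems.PoincareLipschitzMaximalGoodShell

/-!
# Line «poincare_lipschitz» on crux `HistoryTailL` (stmt-QuantumFields-19936), route crux `BlockLipschitzL` (stmt-QuantumFields-23533), K2 organ of record LOC-REG-MIN —
# FLAT SHADOW «ENERGY → RANGE» (E→R) FOR LATTICE MINIMISERS INTO A SPHERE, FILE 5d-F3b′ (d = 3): THE LOG-FREE MOLLIFIED ONE STEP —
# the shell-agnostic core ★★`oneStep_of_goodBands` of ✓`oneStep_mollified` (good dyadic bands as a HYPOTHESIS) and its instance ★★★`oneStep_mollified_logfree`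
# on px7 g5's LOG-FREE good shell ✓`exists_goodRadius_dyadic_logfree` (`G = 16·E_r∕(q−p+1)`, no `(n+3)²`): the first brick of the LOG-FREE F5 re-assembly

Cell `ym3-torus` (YM ladder rung R3 = continuum SU(2) Yang–Mills on the three-torus — a RUNG, NOT the Clay problem: not d = 4, not infinite volume, not a mass gap); width seat
`ym-ust-19936-w5` gen 12 (LEAD ym-ust-19936-w1 g9 g9-6 (ii) `hLogFreeDecay`; 06:49:23Z «LOG-FREE F5: ★w5 first refusal on the re-assembly, px7 second chair»; px7 g5 ✓p705661).
THEOREMS ONLY (def-free), `d = 3`, `V` finite-dimensional real inner-product space; `--supports stmt-QuantumFields-19936`.  Nothing here proves `hLogFreeDecay`, `hC`, `hImprove`, `hRegH`,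
LOC-REG-MIN, a stub, `BlockLipschitzL`, `HistoryTailL` or a summit statement.
[folklore] ([SchoenUhlenbeck1982] §4 small-energy improvement with the mollified comparison map; [Giaquinta1984] Ch. III; lattice statements and constants are this file's).
-/

set_option autoImplicit false

noncomputable section

open scoped BigOperators InnerProductSpace
open Finset

namespace Summit.QuantumFields.YangMills.Theorems.PoincareLipschitzSphereMapSmallEnergyMollifiedLogFree

open Literature.MathematicalPhysics.QuantumFieldTheory.Balaban1983to89
open B4Eq19LatticeOperators
open Summit.QuantumFields.YangMills.Theorems.PoincareLipschitzSphereMapTentOneStep (oneStep_tent)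
open Summit.QuantumFields.YangMills.Theorems.PoincareLipschitzSphereMapSmallEnergyUnmollified (inv_sq_sub_one_le sum_box_le_sum_box)
open Summit.QuantumFields.YangMills.Theorems.PoincareLipschitzSphereMapNearSphereFromBands (norm_tentMollifier_ge_of_bands energy_U_le_of_bands)
open Summit.QuantumFields.YangMills.Theorems.PoincareLipschitzSphereMapSmallEnergyMollified (two_mul_decayConst_three_le mollifierConst_three_le
  toNat_two_pow_div_four oneStep_bookkeeping)
open Summit.QuantumFields.YangMills.Theorems.PoincareLipschitzMaximalGoodShell (exists_goodRadius_dyadic_logfree)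

variable {V : Type*} [NormedAddCommGroup V] [InnerProductSpace ℝ V]

/-- ★★ **THE ONE STEP FROM GOOD DYADIC BANDS** (`d = 3`, the shell-agnostic core of ✓`oneStep_mollified`).  `u : ℤ³ → V` unit-valued, almost minimising on `Q_r(z)` with
constant slack `sl`; a radius `r′ ≤ r` with `2^{n+2} + 2 ≤ r′` whose dyadic bands `Q_{r′−2^k} ∖ Q_{r′−2^{k+2}}`, `k ≤ n+2`, carry energy `≤ G·2^k`; `E_r := E(u;Q_r(z))`,
`a := 2^{n+1} + 1`, ONE displayed smallness `6r√(E_r∕a³) + 2a√(3E_r∕a³) + 2√(6G) ≤ η ≤ ¼`.  THEN with `R := r′ − 2^{n+2}`, for every `0 ≤ ρ ≤ R − 2`: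
`E(u;Q_ρ(z)) ≤ 10¹⁴((ρ+1)∕(R−1))³E_r + 2·sl + 8η·E_r + 10¹¹·(2^{n+3}G) + 8·10⁵·√(E_r·(2^{n+3}G))`.  (Proof = ✓`oneStep_mollified`'s, with the shell as a hypothesis:
✓`norm_tentMollifier_ge_of_bands`, ✓`energy_U_le_of_bands`, ✓`oneStep_tent`, ✓`oneStep_bookkeeping`.) [folklore] [cite: SchoenUhlenbeck1982, §4] -/
theorem oneStep_of_goodBands [FiniteDimensional ℝ V] (u : Zd 3 → V) (z : Zd 3) {r r' : ℤ} {n : ℕ}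
    (hr'r : r' ≤ r) (hp : (2 : ℤ) ^ (n + 2) + 2 ≤ r')
    (hu : ∀ y, ‖u y‖ = 1)
    {sl : ℝ} (hminU : ∀ w : Zd 3 → V, (∀ y, ‖w y‖ = 1) → (∀ y ∉ box z (r - 1), w y = u y) →
      ∑ y ∈ box z r, ∑ μ, ‖u (y + unitVec μ) - u y‖ ^ 2 ≤ ∑ y ∈ box z r, ∑ μ, ‖w (y + unitVec μ) - w y‖ ^ 2 + sl)
    {G : ℝ} (hG0 : 0 ≤ G)
    (hgood : ∀ k ≤ n + 2, ∑ w ∈ box z (r' - (2 : ℤ) ^ k) \ box z (r' - (2 : ℤ) ^ (k + 2)), ∑ μ, ‖u (w + unitVec μ) - u w‖ ^ 2 ≤ G * (2 : ℝ) ^ k)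
    {η : ℝ}
    (hη : 6 * (r : ℝ) * Real.sqrt (((((2 : ℝ) ^ (n + 1) + 1) ^ 3))⁻¹ * ∑ y ∈ box z r, ∑ μ, ‖u (y + unitVec μ) - u y‖ ^ 2) +
        2 * ((2 : ℝ) ^ (n + 1) + 1) * Real.sqrt (3 * ((((2 : ℝ) ^ (n + 1) + 1) ^ 3))⁻¹ * ∑ y ∈ box z r, ∑ μ, ‖u (y + unitVec μ) - u y‖ ^ 2) +
        2 * Real.sqrt (6 * G) ≤ η)
    (hη4 : η ≤ 1 / 4) :
    ∀ ρ : ℤ, 0 ≤ ρ → ρ ≤ r' - (2 : ℤ) ^ (n + 2) - 2 →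
      ∑ y ∈ box z ρ, ∑ μ, ‖u (y + unitVec μ) - u y‖ ^ 2 ≤
        (10 : ℝ) ^ 14 * (((ρ : ℝ) + 1) / (((r' - (2 : ℤ) ^ (n + 2) : ℤ) : ℝ) - 1)) ^ 3 * ∑ y ∈ box z r, ∑ μ, ‖u (y + unitVec μ) - u y‖ ^ 2 + 2 * sl +
          8 * η * ∑ y ∈ box z r, ∑ μ, ‖u (y + unitVec μ) - u y‖ ^ 2 +
          (10 : ℝ) ^ 11 * ((2 : ℝ) ^ (n + 3) * G) +
          8 * (10 : ℝ) ^ 5 * Real.sqrt ((∑ y ∈ box z r, ∑ μ, ‖u (y + unitVec μ) - u y‖ ^ 2) * ((2 : ℝ) ^ (n + 3) * G)) := by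
  -- letters
  set E := ∑ y ∈ box z r, ∑ μ, ‖u (y + unitVec μ) - u y‖ ^ 2 with hE
  have hE0 : 0 ≤ E := Finset.sum_nonneg fun _ _ => Finset.sum_nonneg fun _ _ => sq_nonneg _
  set X := (2 : ℝ) ^ (n + 3) * G with hX
  have hX0 : 0 ≤ X := by positivity
  set a : ℝ := (2 : ℝ) ^ (n + 1) + 1 with ha
  have ha0 : 0 < a := by positivity
  have hsq0 : 0 ≤ 2 * Real.sqrt (6 * G) := by positivity
  have hring0 : 0 ≤ 6 * (r : ℝ) * Real.sqrt ((a ^ 3)⁻¹ * E) + 2 * a * Real.sqrt (3 * (a ^ 3)⁻¹ * E) := by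
    have : (0 : ℝ) ≤ r := by exact_mod_cast (by linarith [hp, hr'r, (by positivity : (0 : ℤ) < (2 : ℤ) ^ (n + 2))] : (0 : ℤ) ≤ r)
    positivity
  have hη0 : 0 ≤ η := (add_nonneg hring0 hsq0).trans hη
  have h2G : 2 * Real.sqrt (6 * G) ≤ η := (le_add_of_nonneg_left hring0).trans hη
  -- the radii
  set R : ℤ := r' - (2 : ℤ) ^ (n + 2) with hRdef
  have h2n : (0 : ℤ) < (2 : ℤ) ^ n := by positivity
  have h2n2 : (2 : ℤ) ^ (n + 2) = 4 * (2 : ℤ) ^ n := by ring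
  have hR2 : 2 ≤ R := by rw [hRdef]; linarith [hp]
  have hRr' : R ≤ r' := by rw [hRdef]; linarith [h2n]
  have hs : ((r' - R).toNat / 4 : ℕ) = 2 ^ n := by
    have : r' - R = (2 : ℤ) ^ (n + 2) := by rw [hRdef]; ring
    rw [this]; exact toNat_two_pow_div_four n
  intro ρ hρ hρR
  -- the tent mollifier and its near-sphere data
  set c : Zd 3 → V := fun y => (((box y ((((min (r' - ((Finset.univ.sup fun j => (y j - z j).natAbs : ℕ) : ℤ))
        (((Finset.univ.sup fun j => (y j - z j).natAbs : ℕ) : ℤ) - (2 * R - r'))).toNat / 4 : ℕ) : ℤ))).card : ℝ))⁻¹ •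
      ∑ w ∈ box y ((((min (r' - ((Finset.univ.sup fun j => (y j - z j).natAbs : ℕ) : ℤ))
        (((Finset.univ.sup fun j => (y j - z j).natAbs : ℕ) : ℤ) - (2 * R - r'))).toNat / 4 : ℕ) : ℤ)), u w with hcdef
  have hc : ∀ y, c y = (((box y ((((min (r' - ((Finset.univ.sup fun j => (y j - z j).natAbs : ℕ) : ℤ))
        (((Finset.univ.sup fun j => (y j - z j).natAbs : ℕ) : ℤ) - (2 * R - r'))).toNat / 4 : ℕ) : ℤ))).card : ℝ))⁻¹ •
      ∑ w ∈ box y ((((min (r' - ((Finset.univ.sup fun j => (y j - z j).natAbs : ℕ) : ℤ))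
        (((Finset.univ.sup fun j => (y j - z j).natAbs : ℕ) : ℤ) - (2 * R - r'))).toNat / 4 : ℕ) : ℤ)), u w := fun y => rfl
  have hnear : ∀ y ∉ box z (R - 1), 1 - 2 * Real.sqrt (6 * G) ≤ ‖c y‖ := fun y hy =>
    norm_tentMollifier_ge_of_bands u c z (n := n + 2) hRdef hu hc hG0 hgood hy
  have hm : 0 < 1 - η := by linarith
  have hm1 : 1 - η ≤ 1 := by linarith
  have hR1 : 1 ≤ R := by linarith
  -- the ring defect at scale `s = 2^n`
  have hE' : ∑ w ∈ box z (R + ((2 ^ n : ℕ) : ℤ) + 1), ∑ μ, ‖u (w + unitVec μ) - u w‖ ^ 2 ≤ E := by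
    rw [hE]; refine sum_box_le_sum_box u z ?_; push_cast; rw [hRdef]; linarith
  have hE'0 : 0 ≤ ∑ w ∈ box z (R + ((2 ^ n : ℕ) : ℤ) + 1), ∑ μ, ‖u (w + unitVec μ) - u w‖ ^ 2 :=
    Finset.sum_nonneg fun _ _ => Finset.sum_nonneg fun _ _ => sq_nonneg _
  have hacast : (((2 * ((2 ^ n : ℕ) : ℤ) + 1 : ℤ) : ℝ)) = a := by rw [ha]; push_cast; ring
  have hRle : (R : ℝ) ≤ r := by exact_mod_cast (by linarith : R ≤ r)
  have hR0 : (0 : ℝ) ≤ R := by exact_mod_cast (by linarith : (0 : ℤ) ≤ R)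
  have hmH : 1 - η ≤ 1 - (2 * ((3 : ℕ) : ℝ) * R * Real.sqrt (((a ^ 3))⁻¹ * ∑ w ∈ box z (R + ((2 ^ n : ℕ) : ℤ) + 1), ∑ μ, ‖u (w + unitVec μ) - u w‖ ^ 2) +
      2 * a * Real.sqrt (((3 : ℕ) : ℝ) * ((a ^ 3))⁻¹ * ∑ w ∈ box z (R + ((2 ^ n : ℕ) : ℤ) + 1), ∑ μ, ‖u (w + unitVec μ) - u w‖ ^ 2)) := by
    have ha3 : 0 ≤ (a ^ 3)⁻¹ := by positivity
    have h1 : Real.sqrt ((a ^ 3)⁻¹ * ∑ w ∈ box z (R + ((2 ^ n : ℕ) : ℤ) + 1), ∑ μ, ‖u (w + unitVec μ) - u w‖ ^ 2) ≤ Real.sqrt ((a ^ 3)⁻¹ * E) :=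
      Real.sqrt_le_sqrt (mul_le_mul_of_nonneg_left hE' ha3)
    have h2 : Real.sqrt (((3 : ℕ) : ℝ) * (a ^ 3)⁻¹ * ∑ w ∈ box z (R + ((2 ^ n : ℕ) : ℤ) + 1), ∑ μ, ‖u (w + unitVec μ) - u w‖ ^ 2) ≤
        Real.sqrt (3 * (a ^ 3)⁻¹ * E) := by
      have e : ((3 : ℕ) : ℝ) = 3 := by norm_num
      rw [e]; exact Real.sqrt_le_sqrt (mul_le_mul_of_nonneg_left hE' (by positivity))
    have h3 : 2 * ((3 : ℕ) : ℝ) * R * Real.sqrt ((a ^ 3)⁻¹ * ∑ w ∈ box z (R + ((2 ^ n : ℕ) : ℤ) + 1), ∑ μ, ‖u (w + unitVec μ) - u w‖ ^ 2) ≤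
        6 * (r : ℝ) * Real.sqrt ((a ^ 3)⁻¹ * E) := by
      have e : ((3 : ℕ) : ℝ) = 3 := by norm_num
      rw [e]
      calc 2 * (3 : ℝ) * R * Real.sqrt ((a ^ 3)⁻¹ * ∑ w ∈ box z (R + ((2 ^ n : ℕ) : ℤ) + 1), ∑ μ, ‖u (w + unitVec μ) - u w‖ ^ 2)
          ≤ 2 * 3 * R * Real.sqrt ((a ^ 3)⁻¹ * E) := mul_le_mul_of_nonneg_left h1 (by positivity)
        _ ≤ 2 * 3 * (r : ℝ) * Real.sqrt ((a ^ 3)⁻¹ * E) := by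
          have := Real.sqrt_nonneg ((a ^ 3)⁻¹ * E)
          nlinarith
        _ = 6 * (r : ℝ) * Real.sqrt ((a ^ 3)⁻¹ * E) := by ring
    have h4 : 2 * a * Real.sqrt (((3 : ℕ) : ℝ) * (a ^ 3)⁻¹ * ∑ w ∈ box z (R + ((2 ^ n : ℕ) : ℤ) + 1), ∑ μ, ‖u (w + unitVec μ) - u w‖ ^ 2) ≤
        2 * a * Real.sqrt (3 * (a ^ 3)⁻¹ * E) := mul_le_mul_of_nonneg_left h2 (by positivity)
    have h5 : 6 * (r : ℝ) * Real.sqrt ((a ^ 3)⁻¹ * E) + 2 * a * Real.sqrt (3 * (a ^ 3)⁻¹ * E) + 2 * Real.sqrt (6 * G) ≤ η := hη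
    linarith
  have hRr : R ≤ r := hRr'.trans hr'r
  -- bookkeeping (before the one step; term-mode ∕ `ring` ∕ `positivity` only)
  have hU : box z (r' - 1) \ box z (2 * R - r') = box z (r' - 1) \ box z (r' - (2 : ℤ) ^ (n + 3)) := by
    congr 2; rw [hRdef]; ring
  have hEU : ∑ y ∈ box z (r' - 1) \ box z (2 * R - r'), ∑ μ, ‖u (y + unitVec μ) - u y‖ ^ 2 ≤ X := by
    rw [hU, hX]
    have := energy_U_le_of_bands u z r' (n + 2) hG0 hgood
    rw [show n + 2 + 1 = n + 3 from rfl] at this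
    exact this
  have hEU0 : 0 ≤ ∑ y ∈ box z (r' - 1) \ box z (2 * R - r'), ∑ μ, ‖u (y + unitVec μ) - u y‖ ^ 2 :=
    Finset.sum_nonneg fun _ _ => Finset.sum_nonneg fun _ _ => sq_nonneg _
  have hER : ∑ y ∈ box z R, ∑ μ, ‖u (y + unitVec μ) - u y‖ ^ 2 ≤ E := by rw [hE]; exact sum_box_le_sum_box u z hRr
  have hER0 : 0 ≤ ∑ y ∈ box z R, ∑ μ, ‖u (y + unitVec μ) - u y‖ ^ 2 := Finset.sum_nonneg fun _ _ => Finset.sum_nonneg fun _ _ => sq_nonneg _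
  have hden : (((R - 2 : ℤ) : ℝ) + 1) = (R : ℝ) - 1 := by push_cast; ring
  have hf0 : 0 ≤ (((ρ : ℝ) + 1) / ((R : ℝ) - 1)) ^ 3 := by
    have h1R : (1 : ℝ) ≤ R := by exact_mod_cast hR1
    have hρ0 : (0 : ℝ) ≤ ρ := by exact_mod_cast hρ
    exact pow_nonneg (div_nonneg (add_nonneg hρ0 zero_le_one) (sub_nonneg.mpr h1R)) 3
  have hA0 : 0 ≤ (2 : ℝ) ^ 3 * (1 + 56 * ((3 : ℕ) : ℝ)) ^ 3 * (8 * (((3 : ℕ) : ℝ) + 1)) ^ (3 + 1) := by positivity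
  have hC0 : 0 ≤ ((3 : ℕ) : ℝ) * ((2 + 4 * ((3 : ℕ) : ℝ)) ^ 2 * ((3 : ℕ) : ℝ) * (21 : ℝ) ^ 3) * (((2 : ℕ) : ℝ) + (3 : ℕ) + 1) ^ 3 := by positivity
  have hbook := oneStep_bookkeeping (sl := sl) two_mul_decayConst_three_le hA0 mollifierConst_three_le hC0 hf0 hER hER0 hEU hEU0 hη0 hη4
  -- the one step (taken LAST: nothing runs once the large `h` is in scope; the near-sphere rows are passed inline so that no comparison hypothesis mentioning `c` is ever named)
  have h := oneStep_tent (d := 3) (by norm_num) u c z (r := r) (r' := r') (R := R) hu hc hR1 hRr' hr'r hminU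
    (fun y hy => by linarith [hnear y hy]) hm hm1 (fun y _ hy => by linarith [hnear y hy]) (by rw [hs, hacast]; exact hmH) hρ hρR
  rw [hden] at h
  exact h.trans hbook

/-- ★★★ **THE LOG-FREE MOLLIFIED ONE STEP** (`d = 3`): ✓`oneStep_of_goodBands` fed by px7 g5's LOG-FREE good shell ✓`exists_goodRadius_dyadic_logfree` (rising-sun ∕ maximal-function
Chebyshev, constant `4·(4∕3)` in place of px8's `4(k+1)²`): radii `2^{n+2} + 2 ≤ p ≤ q`, room `q + 2^{n+4} ≤ r`; `G := 16·E_r∕(q−p+1)` is `n`-FREE; smallness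
`6r√(E_r∕a³) + 2a√(3E_r∕a³) + 2√(6G) ≤ η ≤ ¼`.  THEN `∃ R ∈ [p − 2^{n+2}, q − 2^{n+2}]` with, for `0 ≤ ρ ≤ R − 2`:
`E_ρ ≤ 10¹⁴((ρ+1)∕(R−1))³E_r + 2·sl + 8η·E_r + 10¹¹·X + 8·10⁵·√(E_r·X)`, `X = 2^{n+3}·G`. [folklore] [cite: SchoenUhlenbeck1982, §4] -/
theorem oneStep_mollified_logfree [FiniteDimensional ℝ V] (u : Zd 3 → V) (z : Zd 3) {r p q : ℤ} {n : ℕ}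
    (hpq : p ≤ q) (hqr : q + (2 : ℤ) ^ (n + 4) ≤ r) (hp : (2 : ℤ) ^ (n + 2) + 2 ≤ p)
    (hu : ∀ y, ‖u y‖ = 1)
    {sl : ℝ} (hminU : ∀ w : Zd 3 → V, (∀ y, ‖w y‖ = 1) → (∀ y ∉ box z (r - 1), w y = u y) →
      ∑ y ∈ box z r, ∑ μ, ‖u (y + unitVec μ) - u y‖ ^ 2 ≤ ∑ y ∈ box z r, ∑ μ, ‖w (y + unitVec μ) - w y‖ ^ 2 + sl)
    {η : ℝ}
    (hη : 6 * (r : ℝ) * Real.sqrt (((((2 : ℝ) ^ (n + 1) + 1) ^ 3))⁻¹ * ∑ y ∈ box z r, ∑ μ, ‖u (y + unitVec μ) - u y‖ ^ 2) +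
        2 * ((2 : ℝ) ^ (n + 1) + 1) * Real.sqrt (3 * ((((2 : ℝ) ^ (n + 1) + 1) ^ 3))⁻¹ * ∑ y ∈ box z r, ∑ μ, ‖u (y + unitVec μ) - u y‖ ^ 2) +
        2 * Real.sqrt (6 * (16 * (∑ y ∈ box z r, ∑ μ, ‖u (y + unitVec μ) - u y‖ ^ 2) / (((q - p + 1 : ℤ) : ℝ)))) ≤ η)
    (hη4 : η ≤ 1 / 4) :
    ∃ R : ℤ, p - (2 : ℤ) ^ (n + 2) ≤ R ∧ R ≤ q - (2 : ℤ) ^ (n + 2) ∧ ∀ ρ : ℤ, 0 ≤ ρ → ρ ≤ R - 2 →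
      ∑ y ∈ box z ρ, ∑ μ, ‖u (y + unitVec μ) - u y‖ ^ 2 ≤
        (10 : ℝ) ^ 14 * (((ρ : ℝ) + 1) / ((R : ℝ) - 1)) ^ 3 * ∑ y ∈ box z r, ∑ μ, ‖u (y + unitVec μ) - u y‖ ^ 2 + 2 * sl +
          8 * η * ∑ y ∈ box z r, ∑ μ, ‖u (y + unitVec μ) - u y‖ ^ 2 +
          (10 : ℝ) ^ 11 * ((2 : ℝ) ^ (n + 3) * (16 * (∑ y ∈ box z r, ∑ μ, ‖u (y + unitVec μ) - u y‖ ^ 2) / (((q - p + 1 : ℤ) : ℝ)))) +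
          8 * (10 : ℝ) ^ 5 * Real.sqrt ((∑ y ∈ box z r, ∑ μ, ‖u (y + unitVec μ) - u y‖ ^ 2) *
            ((2 : ℝ) ^ (n + 3) * (16 * (∑ y ∈ box z r, ∑ μ, ‖u (y + unitVec μ) - u y‖ ^ 2) / (((q - p + 1 : ℤ) : ℝ))))) := by
  have hqp0 : (0 : ℝ) < ((q - p + 1 : ℤ) : ℝ) := by exact_mod_cast (by omega : (0 : ℤ) < q - p + 1)
  have h2n4 : (0 : ℤ) < (2 : ℤ) ^ (n + 4) := by positivity
  -- px7's log-free good radius, `n + 3` bands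
  obtain ⟨r', hr'I, hgood0⟩ := exists_goodRadius_dyadic_logfree z r hpq (n + 3) (by rw [show n + 3 + 1 = n + 4 from rfl]; exact hqr)
    (fun y => ∑ μ, ‖u (y + unitVec μ) - u y‖ ^ 2) (fun y => Finset.sum_nonneg fun _ _ => sq_nonneg _)
  rw [Finset.mem_Icc] at hr'I
  obtain ⟨hpr', hr'q⟩ := hr'I
  have hE0 : 0 ≤ ∑ y ∈ box z r, ∑ μ, ‖u (y + unitVec μ) - u y‖ ^ 2 := Finset.sum_nonneg fun _ _ => Finset.sum_nonneg fun _ _ => sq_nonneg _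
  have hG0 : 0 ≤ 16 * (∑ y ∈ box z r, ∑ μ, ‖u (y + unitVec μ) - u y‖ ^ 2) / (((q - p + 1 : ℤ) : ℝ)) := by positivity
  have hgood : ∀ k ≤ n + 2, ∑ w ∈ box z (r' - (2 : ℤ) ^ k) \ box z (r' - (2 : ℤ) ^ (k + 2)), ∑ μ, ‖u (w + unitVec μ) - u w‖ ^ 2 ≤
      (16 * (∑ y ∈ box z r, ∑ μ, ‖u (y + unitVec μ) - u y‖ ^ 2) / (((q - p + 1 : ℤ) : ℝ))) * (2 : ℝ) ^ k := by
    intro k hk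
    have h1 := hgood0 k (by omega)
    change ((q - p + 1 : ℤ) : ℝ) * ∑ w ∈ box z (r' - (2 : ℤ) ^ k) \ box z (r' - (2 : ℤ) ^ (k + 2)), ∑ μ, ‖u (w + unitVec μ) - u w‖ ^ 2 ≤
      4 * (4 / 3 : ℝ) * ((3 * (2 : ℝ) ^ k) * (∑ y ∈ box z r, ∑ μ, ‖u (y + unitVec μ) - u y‖ ^ 2)) at h1
    rw [div_mul_eq_mul_div, le_div_iff₀ hqp0]
    calc (∑ w ∈ box z (r' - (2 : ℤ) ^ k) \ box z (r' - (2 : ℤ) ^ (k + 2)), ∑ μ, ‖u (w + unitVec μ) - u w‖ ^ 2) * (((q - p + 1 : ℤ) : ℝ))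
        = ((q - p + 1 : ℤ) : ℝ) * ∑ w ∈ box z (r' - (2 : ℤ) ^ k) \ box z (r' - (2 : ℤ) ^ (k + 2)), ∑ μ, ‖u (w + unitVec μ) - u w‖ ^ 2 := mul_comm _ _
      _ ≤ 4 * (4 / 3 : ℝ) * ((3 * (2 : ℝ) ^ k) * (∑ y ∈ box z r, ∑ μ, ‖u (y + unitVec μ) - u y‖ ^ 2)) := h1
      _ = 16 * (∑ y ∈ box z r, ∑ μ, ‖u (y + unitVec μ) - u y‖ ^ 2) * (2 : ℝ) ^ k := by ring
  refine ⟨r' - (2 : ℤ) ^ (n + 2), by linarith, by linarith, fun ρ hρ hρR => ?_⟩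
  have h := oneStep_of_goodBands u z (r := r) (r' := r') (n := n) (by linarith) (by linarith) hu hminU hG0 hgood hη hη4 ρ hρ hρR
  push_cast at h ⊢
  exact h

end Summit.QuantumFields.YangMills.Theorems.PoincareLipschitzSphereMapSmallEnergyMollifiedLogFree
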